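import Summits.CriticalPhenomena.PercolationContinuityZ3.Theorems.PercNearOneGluingNoHeavyLowerTailSahiGridPatternTwoOrthantGeneral

/-!
# `NoHeavyLowerTail` (crux stmt-CriticalPhenomena-4575), Sahi programme P1: **PLACEMENT** — a pattern that is good with free axes
# in front (`cylSet`) is good when placed on ANY set of axes of ANY bigger cube

Support file (Sahi cell, seat `prim-sahi-p1`, generation 26; `--supports stmt-CriticalPhenomena-4575`).  Pure proofs, no definitions,
no `sorry`, standard axioms.  A bookkeeping bridge used by the read-once theorems: the tree proves "good in every dimension" statements in
BLOCK FORM (`0 ≤ sStarD (cylSet S) B C` for `cylSet S ⊆ [3]^{m+K}`, free axes first), while inductions over formulas need the pattern `S`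
placed on an arbitrary injective family of axes `σ : Fin K ↪ Fin d`.
* `exists_placement_equiv` — for every injection `σ : Fin K → Fin d` there are `m` and an axis equivalence `e : Fin (m + K) ≃ Fin d` with
  `e (Fin.natAdd m i) = σ i` (the last `K` block axes go to the chosen positions, the first `m` to the rest).
* `sStarD_nonneg_place_of_cylSet` — if `cylSet S ⊆ [3]^{m+K}` is a good first slot for every `m`, then so is the placed pattern
  `{y ∈ [3]^d : (i ↦ y (σ i)) ∈ S}` for every injection `σ`, by `sStarD_nonneg_transfer`.
Nothing here asserts `PatternPos d` for `d ≥ 4`. [this work]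
-/

namespace Summit.CriticalPhenomena.PercolationContinuityZ3.Theorems.SahiGridPattern

open Finset SahiGrid3
open scoped BigOperators

/-- **Placement equivalence**: an injection `σ : Fin K → Fin d` extends to an axis equivalence `e : Fin (m + K) ≃ Fin d`
(`m = d - K`) with `e (Fin.natAdd m i) = σ i`. [this work] -/
theorem exists_placement_equiv : ∀ (K d : ℕ) (σ : Fin K → Fin d), Function.Injective σ →
    ∃ m : ℕ, ∃ e : Fin (m + K) ≃ Fin d, ∀ i : Fin K, e (Fin.natAdd m i) = σ i
  | 0 => by
      intro d σ _
      exact ⟨d, finCongr (Nat.add_zero d), fun i => Fin.elim0 i⟩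
  | K + 1 => by
      intro d σ hσ
      cases d with
      | zero => exact Fin.elim0 (σ 0)
      | succ d' =>
      set p : Fin (d' + 1) := σ (Fin.last K) with hp
      have hg : ∀ j : Fin K, ∃ i : Fin d', p.succAbove i = σ (Fin.castSucc j) := fun j =>
        Fin.exists_succAbove_eq (fun h => Fin.castSucc_lt_last j |>.ne (hσ (h.trans hp)))
      choose g hg using hg
      have hginj : Function.Injective g := fun j j' h => by
        have e := congrArg p.succAbove h
        rw [hg, hg] at e
        exact Fin.castSucc_injective _ (hσ e)
      obtain ⟨m, e', he'⟩ := exists_placement_equiv K d' g hginj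
      let e'' : Fin ((m + K) + 1) ≃ Fin (d' + 1) :=
        ((finSuccEquiv' (Fin.last (m + K))).trans (Equiv.optionCongr e')).trans (finSuccEquiv' p).symm
      refine ⟨m, e'', fun i => ?_⟩
      refine Fin.lastCases ?_ (fun j => ?_) i
      · have e1 : (Fin.natAdd m (Fin.last K) : Fin (m + (K + 1))) = Fin.last (m + K) := Fin.ext rfl
        rw [e1]
        show (finSuccEquiv' p).symm (Equiv.optionCongr e' (finSuccEquiv' (Fin.last (m + K)) (Fin.last (m + K)))) = σ (Fin.last K)
        rw [finSuccEquiv'_at, Equiv.optionCongr_apply, Option.map_none, finSuccEquiv'_symm_none]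
      · have e1 : (Fin.natAdd m (Fin.castSucc j) : Fin (m + (K + 1))) = (Fin.last (m + K)).succAbove (Fin.natAdd m j) := by
          rw [Fin.succAbove_last]; exact Fin.ext rfl
        rw [e1]
        show (finSuccEquiv' p).symm (Equiv.optionCongr e' (finSuccEquiv' (Fin.last (m + K)) ((Fin.last (m + K)).succAbove (Fin.natAdd m j))))
          = σ (Fin.castSucc j)
        rw [finSuccEquiv'_succAbove, Equiv.optionCongr_apply, Option.map_some, finSuccEquiv'_symm_some, he', hg]

/-- **Placing a pattern that is good in block form**: if `cylSet S ⊆ [3]^{m+K}` is a good first slot for every number `m` of free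
axes, then for every injection `σ : Fin K → Fin d` the pattern `S` read on the axes `σ` (all other axes free) is a good first slot of
`[3]^d`. [this work] -/
theorem sStarD_nonneg_place_of_cylSet {K : ℕ} {S : Finset (Pd K)}
    (hS : ∀ (m : ℕ) (B C : Finset (Pd (m + K))), IsUpperSet (B : Set (Pd (m + K))) → IsUpperSet (C : Set (Pd (m + K))) →
      0 ≤ sStarD (cylSet S : Finset (Pd (m + K))) B C)
    {d : ℕ} (σ : Fin K → Fin d) (hσ : Function.Injective σ)
    {A : Finset (Pd d)} (hA : ∀ y : Pd d, y ∈ A ↔ (fun i => y (σ i)) ∈ S) :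
    ∀ B C : Finset (Pd d), IsUpperSet (B : Set (Pd d)) → IsUpperSet (C : Set (Pd d)) → 0 ≤ sStarD A B C := by
  obtain ⟨m, e, he⟩ := exists_placement_equiv K d σ hσ
  refine sStarD_nonneg_transfer e (hS m) fun y => ?_
  rw [hA y, mem_cylSet_iff]
  have h : (fun i => y (σ i)) = cellOf (n := m) (y ∘ e) := by
    funext i; simp only [cellOf, Function.comp_apply, he]
  rw [h]

end Summit.CriticalPhenomena.PercolationContinuityZ3.Theorems.SahiGridPattern
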